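import Summits.CriticalPhenomena.SAWScalingLimit.Theorems.SAWReversalUpgradePathUpgradeRFlankL
import Summits.CriticalPhenomena.SAWScalingLimit.Theorems.SAWReversalUpgradePathUpgradeRCompat
import Summits.CriticalPhenomena.SAWScalingLimit.Theorems.SAWReversalUpgradePathUpgradeRLatticeDictionary
import Summits.CriticalPhenomena.SAWScalingLimit.Theorems.SAWReversalUpgradePathUpgradeRInstA
import Literature.Probability.RandomPlanarGeometry.DrivingFunctionMeasurable
import Literature.Probability.RandomPlanarGeometry.LoopSpaceMaps
import Literature.Probability.RandomPlanarGeometry.ChordalReversibility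
import HarnessLib

/-!
# `PathUpgradeR`, line `bidir_windows`, the lead's stub `stub_returnsDie` — part 2b: the per-sample INSTANTIATION
(crux stmt-CriticalPhenomena-18055, route `SAWReversalUpgrade`)

For ONE simple curve `X` from `a` to `b`, interior in `D`, describable by the Loewner evolution both forwards
(through `φ`) and backwards (its reversal, through `φ'` of `D.swap`), whose forward driver `W` and backward driver
`W'` carry GOOD reference data `ρ`, `ρ'` (the bundles `GoodF`, `GoodB` below: shadowing of the closed hulls,
injectivity/continuity moduli of the references, driver oscillation, conformal farness of gate/far points,
distance-to-boundary and endpoint clauses, porosity), with gate decompositions (`stub_gate`) available for every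
continuous driver, and which avoids the six "window" events of H6/H7 and has the two capacity-approach points,
there is NO `(ℓ, ε)`-return.  Proof: unpack `stub_latticeDictionary` twice, `stub_flank` twice, `stub_compat`, and
the deterministic core `PathUpgradeRCore.no_return`. [folklore]
-/

noncomputable section

open Set Metric Filter Topology
open scoped unitInterval NNReal

namespace Summit.CriticalPhenomena.SAWScalingLimit.Theorems.PathUpgradeRInst

open Literature.Probability.RandomPlanarGeometry

/-- Image of an initial interval under the symmetry of the unit interval. [folklore] -/
theorem image_symm_Icc_zero (u : I) : σ '' Icc 0 u = Icc (σ u) 1 := by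
  ext v
  constructor
  · rintro ⟨t, ht, rfl⟩
    exact ⟨unitInterval.symm_le_symm.2 ht.2, unitInterval.le_one _⟩
  · intro hv
    refine ⟨σ v, ⟨unitInterval.nonneg _, ?_⟩, unitInterval.symm_symm v⟩
    have := unitInterval.symm_le_symm.2 hv.1
    rwa [unitInterval.symm_symm] at this

/-- **INSTANTIATION** (see the module docstring). -/
theorem inst (D : DobrushinDomain) (φ : ConformalEquiv UpperHalfPlane.upperHalfPlaneSet D.carrier)
    (hφ : D.IsChordalUniformizing φ) (φ' : ConformalEquiv UpperHalfPlane.upperHalfPlaneSet D.swap.carrier)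
    (hφ' : D.swap.IsChordalUniformizing φ')
    (X : Curve ℂ) (hXinj : Function.Injective X) (hX0 : X.source = D.pt 0) (hX1 : X.target = D.pt 1)
    (hXint : ∀ t : I, X t = D.pt 0 ∨ X t = D.pt 1 ∨ X t ∈ D.carrier)
    (hdescF : IsLoewnerDescribable φ (CurveClass.mk X))
    (hdescB : IsLoewnerDescribable φ' (CurveClass.mk X.reverse))
    (ρ ρ' : ℝ≥0 → ℂ) (T T' : ℝ≥0)
    (ε μ μ₀ μS w c₀ ν θ ρ₁ m₁ h₀ d' dS lam r₁ Rout α₀ dB Ttop raF raP rbF rbP rbW ℓ : ℝ)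
    (ε' μ' μ₀' w' c₁ θ' ρ₁' m₁' h₀' d'' lam' r₁' Rout' α₀' dB' raW : ℝ)
    (ra rb ra' rb' ra'' rb'' L L' : ℝ)
    (hgoodF : ((Continuous ρ ∧ (∀ u : NNReal, 0 ≤ (ρ u).im) ∧ ρ 0 = 0 ∧
  (∀ t : NNReal, 0 < t → (t : ℝ) ≤ T + 1 →
    Metric.hausdorffDist (φ.boundaryExtension '' closure (Literature.Probability.RandomPlanarGeometry.Loewner.hull (Literature.Probability.RandomPlanarGeometry.drivingFunction φ (Literature.Probability.RandomPlanarGeometry.CurveClass.mk X)) t))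
      ((fun u => φ.boundaryExtension (ρ u)) '' Set.Icc 0 t) ≤ ε) ∧
  (∀ s t : NNReal, (s : ℝ) ≤ T + 1 → (t : ℝ) ≤ T + 1 → w ≤ |(s : ℝ) - t| →
    μ ≤ dist (φ.boundaryExtension (ρ s)) (φ.boundaryExtension (ρ t))) ∧
  (∀ s t : NNReal, (s : ℝ) ≤ T + 1 → (t : ℝ) ≤ T + 1 → c₀ / 4 ≤ |(s : ℝ) - t| →
    μ₀ ≤ dist (φ.boundaryExtension (ρ s)) (φ.boundaryExtension (ρ t))) ∧
  (∀ s s' : NNReal, (s : ℝ) ≤ T + 1 → (s' : ℝ) ≤ T + 1 → |(s : ℝ) - s'| ≤ θ + 4 * w →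
    |(Literature.Probability.RandomPlanarGeometry.drivingFunction φ (Literature.Probability.RandomPlanarGeometry.CurveClass.mk X)) s - (Literature.Probability.RandomPlanarGeometry.drivingFunction φ (Literature.Probability.RandomPlanarGeometry.CurveClass.mk X)) s'| ≤ ρ₁) ∧
  (∀ t₁ : NNReal, (t₁ : ℝ) ≤ T → ∃ u : NNReal, (t₁ : ℝ) + 2 * θ ≤ u ∧ (u : ℝ) ≤ t₁ + L * θ ∧
    ρ u ∈ Literature.Probability.RandomPlanarGeometry.Loewner.domain (Literature.Probability.RandomPlanarGeometry.drivingFunction φ (Literature.Probability.RandomPlanarGeometry.CurveClass.mk X)) t₁ ∧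
    m₁ ≤ ‖Literature.Probability.RandomPlanarGeometry.Loewner.map (Literature.Probability.RandomPlanarGeometry.drivingFunction φ (Literature.Probability.RandomPlanarGeometry.CurveClass.mk X)) t₁ (ρ u) - (Literature.Probability.RandomPlanarGeometry.drivingFunction φ (Literature.Probability.RandomPlanarGeometry.CurveClass.mk X)) t₁‖) ∧
  (∀ t₁ : NNReal, (t₁ : ℝ) ≤ T → ∀ e ∈ D.carrier,
    d' ≤ Metric.infDist e ((fun u => φ.boundaryExtension (ρ u)) '' Set.Icc 0 (T + 1) ∪ frontier D.carrier) →
    φ.symm e ∈ Literature.Probability.RandomPlanarGeometry.Loewner.domain (Literature.Probability.RandomPlanarGeometry.drivingFunction φ (Literature.Probability.RandomPlanarGeometry.CurveClass.mk X)) t₁ ∧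
    h₀ ≤ (Literature.Probability.RandomPlanarGeometry.Loewner.map (Literature.Probability.RandomPlanarGeometry.drivingFunction φ (Literature.Probability.RandomPlanarGeometry.CurveClass.mk X)) t₁ (φ.symm e)).im) ∧
  (∀ u : NNReal, α₀ / 2 ≤ (u : ℝ) → (u : ℝ) ≤ T + 1 →
    dB ≤ Metric.infDist (φ.boundaryExtension (ρ u)) (frontier D.carrier)) ∧
  (∀ u : NNReal, (u : ℝ) ≤ T + 1 → (u : ℝ) < α₀ →
    dist (φ.boundaryExtension (ρ u)) (D.pt 0) < raP - ε)) ∧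
  ((∀ s t : NNReal, (s : ℝ) ≤ T + 1 → (t : ℝ) ≤ T + 1 → c₀ ≤ |(s : ℝ) - t| →
    μS ≤ dist (φ.boundaryExtension (ρ s)) (φ.boundaryExtension (ρ t))) ∧
  (∀ s t : NNReal, (s : ℝ) ≤ T + 1 → (t : ℝ) ≤ T + 1 → |(s : ℝ) - t| ≤ 2 * w →
    dist (φ.boundaryExtension (ρ s)) (φ.boundaryExtension (ρ t)) ≤ ν) ∧
  (∀ s t : NNReal, (s : ℝ) ≤ T + 1 → (t : ℝ) ≤ T + 1 → |(s : ℝ) - t| < 9 * c₀ + w →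
    dist (φ.boundaryExtension (ρ s)) (φ.boundaryExtension (ρ t)) < ℓ - 2 * ε) ∧
  (∀ u' u : NNReal, u' ≤ u → (u : ℝ) ≤ T + 1 → raF - ε ≤ dist (φ.boundaryExtension (ρ u')) (D.pt 0) →
    raP + ε + 2 * dS ≤ dist (φ.boundaryExtension (ρ u)) (D.pt 0)) ∧
  (∀ u : NNReal, (u : ℝ) ≤ T + 1 → Ttop < (u : ℝ) → dist (φ.boundaryExtension (ρ u)) (D.pt 1) < rbF - ε) ∧
  (∀ u u' : NNReal, u ≤ u' → (u' : ℝ) ≤ T + 1 → rbF - ε ≤ dist (φ.boundaryExtension (ρ u')) (D.pt 1) →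
    rbP + ε + 2 * dS ≤ dist (φ.boundaryExtension (ρ u)) (D.pt 1)) ∧
  (dist (φ.boundaryExtension (ρ (T + 1))) (D.pt 1) + ε ≤ rbW) ∧
  (∀ (y : ℂ) (u : NNReal), α₀ ≤ (u : ℝ) → (u : ℝ) ≤ Ttop + w → dist y (φ.boundaryExtension (ρ u)) ≤ ε →
    ∃ e ∈ D.carrier, dist e y ≤ 2 * dS ∧
      d' ≤ Metric.infDist e ((fun u => φ.boundaryExtension (ρ u)) '' Set.Icc 0 (T + 1) ∪ frontier D.carrier)))))
    (hgoodB : ((Continuous ρ' ∧ (∀ u : NNReal, 0 ≤ (ρ' u).im) ∧ ρ' 0 = 0 ∧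
  (∀ t : NNReal, 0 < t → (t : ℝ) ≤ T' + 1 →
    Metric.hausdorffDist (φ'.boundaryExtension '' closure (Literature.Probability.RandomPlanarGeometry.Loewner.hull (Literature.Probability.RandomPlanarGeometry.drivingFunction φ' (Literature.Probability.RandomPlanarGeometry.CurveClass.mk X.reverse)) t))
      ((fun u => φ'.boundaryExtension (ρ' u)) '' Set.Icc 0 t) ≤ ε') ∧
  (∀ s t : NNReal, (s : ℝ) ≤ T' + 1 → (t : ℝ) ≤ T' + 1 → w' ≤ |(s : ℝ) - t| →
    μ' ≤ dist (φ'.boundaryExtension (ρ' s)) (φ'.boundaryExtension (ρ' t))) ∧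
  (∀ s t : NNReal, (s : ℝ) ≤ T' + 1 → (t : ℝ) ≤ T' + 1 → c₁ / 4 ≤ |(s : ℝ) - t| →
    μ₀' ≤ dist (φ'.boundaryExtension (ρ' s)) (φ'.boundaryExtension (ρ' t))) ∧
  (∀ s s' : NNReal, (s : ℝ) ≤ T' + 1 → (s' : ℝ) ≤ T' + 1 → |(s : ℝ) - s'| ≤ θ' + 4 * w' →
    |(Literature.Probability.RandomPlanarGeometry.drivingFunction φ' (Literature.Probability.RandomPlanarGeometry.CurveClass.mk X.reverse)) s - (Literature.Probability.RandomPlanarGeometry.drivingFunction φ' (Literature.Probability.RandomPlanarGeometry.CurveClass.mk X.reverse)) s'| ≤ ρ₁') ∧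
  (∀ t₁ : NNReal, (t₁ : ℝ) ≤ T' → ∃ u : NNReal, (t₁ : ℝ) + 2 * θ' ≤ u ∧ (u : ℝ) ≤ t₁ + L' * θ' ∧
    ρ' u ∈ Literature.Probability.RandomPlanarGeometry.Loewner.domain (Literature.Probability.RandomPlanarGeometry.drivingFunction φ' (Literature.Probability.RandomPlanarGeometry.CurveClass.mk X.reverse)) t₁ ∧
    m₁' ≤ ‖Literature.Probability.RandomPlanarGeometry.Loewner.map (Literature.Probability.RandomPlanarGeometry.drivingFunction φ' (Literature.Probability.RandomPlanarGeometry.CurveClass.mk X.reverse)) t₁ (ρ' u) - (Literature.Probability.RandomPlanarGeometry.drivingFunction φ' (Literature.Probability.RandomPlanarGeometry.CurveClass.mk X.reverse)) t₁‖) ∧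
  (∀ t₁ : NNReal, (t₁ : ℝ) ≤ T' → ∀ e ∈ D.swap.carrier,
    d'' ≤ Metric.infDist e ((fun u => φ'.boundaryExtension (ρ' u)) '' Set.Icc 0 (T' + 1) ∪ frontier D.swap.carrier) →
    φ'.symm e ∈ Literature.Probability.RandomPlanarGeometry.Loewner.domain (Literature.Probability.RandomPlanarGeometry.drivingFunction φ' (Literature.Probability.RandomPlanarGeometry.CurveClass.mk X.reverse)) t₁ ∧
    h₀' ≤ (Literature.Probability.RandomPlanarGeometry.Loewner.map (Literature.Probability.RandomPlanarGeometry.drivingFunction φ' (Literature.Probability.RandomPlanarGeometry.CurveClass.mk X.reverse)) t₁ (φ'.symm e)).im) ∧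
  (∀ u : NNReal, α₀' / 2 ≤ (u : ℝ) → (u : ℝ) ≤ T' + 1 →
    dB' ≤ Metric.infDist (φ'.boundaryExtension (ρ' u)) (frontier D.swap.carrier)) ∧
  (∀ u : NNReal, (u : ℝ) ≤ T' + 1 → (u : ℝ) < α₀' →
    dist (φ'.boundaryExtension (ρ' u)) (D.swap.pt 0) < rbP - ε')) ∧
  (∀ s t : NNReal, (s : ℝ) ≤ T' + 1 → (t : ℝ) ≤ T' + 1 → |(s : ℝ) - t| ≤ c₁ →
    dist (φ'.boundaryExtension (ρ' s)) (φ'.boundaryExtension (ρ' t)) < μ₀ / 2)))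
    (hgate : (∀ (V : NNReal → ℝ), Continuous V → ∀ t₁ : NNReal, ∃ C P Q : Set ℂ,
   (∀ p ∈ C, ∀ q ∈ C, dist p q ≤ lam) ∧ Disjoint P Q ∧ Disjoint P C ∧ Disjoint Q C ∧
   P ∪ Q ∪ C = φ '' (Literature.Probability.RandomPlanarGeometry.Loewner.domain V t₁) ∧
   (∀ S : Set ℂ, IsPreconnected S → S ⊆ P ∪ Q → S ⊆ P ∨ S ⊆ Q) ∧
   (∀ y : ℂ, 0 < y.im → dist y (V t₁) ≤ r₁ → φ (Literature.Probability.RandomPlanarGeometry.Loewner.loewnerInv V t₁ y) ∈ P) ∧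
   (∀ y : ℂ, 0 < y.im → Rout ≤ dist y (V t₁) → φ (Literature.Probability.RandomPlanarGeometry.Loewner.loewnerInv V t₁ y) ∈ Q)))
    (hgate' : (∀ (V : NNReal → ℝ), Continuous V → ∀ t₁ : NNReal, ∃ C P Q : Set ℂ,
   (∀ p ∈ C, ∀ q ∈ C, dist p q ≤ lam') ∧ Disjoint P Q ∧ Disjoint P C ∧ Disjoint Q C ∧
   P ∪ Q ∪ C = φ' '' (Literature.Probability.RandomPlanarGeometry.Loewner.domain V t₁) ∧
   (∀ S : Set ℂ, IsPreconnected S → S ⊆ P ∪ Q → S ⊆ P ∨ S ⊆ Q) ∧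
   (∀ y : ℂ, 0 < y.im → dist y (V t₁) ≤ r₁' → φ' (Literature.Probability.RandomPlanarGeometry.Loewner.loewnerInv V t₁ y) ∈ P) ∧
   (∀ y : ℂ, 0 < y.im → Rout' ≤ dist y (V t₁) → φ' (Literature.Probability.RandomPlanarGeometry.Loewner.loewnerInv V t₁ y) ∈ Q)))
    -- X avoids the window events (negated H6/H7 events) and has the two approach points
    (nB1 : ∀ s t : I, s < t → ℓ / 2 ≤ dist (X s) (D.pt 0) → ra < dist (X t) (D.pt 0))
    (nB2 : ∀ s t : I, s < t → dist (X s) (D.pt 1) ≤ rb → dist (X t) (D.pt 1) < ℓ / 2)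
    (nB3 : ∀ s t : I, s < t → ra / 4 ≤ dist (X s) (D.pt 0) → ra' < dist (X t) (D.pt 0))
    (nB4 : ∀ s t : I, s < t → dist (X s) (D.pt 1) ≤ rb' → dist (X t) (D.pt 1) < rb / 4)
    (nB5 : ∀ s t : I, s < t → raW ≤ dist (X s) (D.pt 0) → ra'' < dist (X t) (D.pt 0))
    (nB6 : ∀ s t : I, s < t → dist (X s) (D.pt 1) ≤ rb'' → dist (X t) (D.pt 1) < rbW)
    (nB7 : ∀ s t : I, s < t → dist (X s) (D.pt 1) ≤ rbW → dist (X t) (D.pt 1) < rbP)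
    (hapF : ∃ t : ℝ≥0, t ≤ T ∧ dist (φ.boundaryExtension
      (Loewner.trace (drivingFunction φ (CurveClass.mk X)) t)) (D.pt 1) < rb'')
    (hapB : ∃ t : ℝ≥0, t ≤ T' ∧ dist (φ'.boundaryExtension
      (Loewner.trace (drivingFunction φ' (CurveClass.mk X.reverse)) t)) (D.pt 0) < ra'')
    -- numeric relations
    (hnum : 0 < ε ∧ 0 < ε' ∧ 5 * ε < μ ∧ 5 * ε' < μ' ∧ 0 < w ∧ 0 < w' ∧ w < θ / 2 ∧ w' < θ' / 2 ∧
      8 * θ < c₀ ∧ 8 * θ' < c₁ ∧ 2 ≤ L ∧ 2 ≤ L' ∧ (L + 1) * θ + w ≤ 1 ∧ (L' + 1) * θ' + w' ≤ 1 ∧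
      0 ≤ ρ₁ ∧ 0 ≤ ρ₁' ∧ 0 < r₁ ∧ 0 < r₁' ∧
      5 * (ρ₁ + Real.sqrt (θ + 4 * w)) ≤ r₁ ∧ 5 * (ρ₁' + Real.sqrt (θ' + 4 * w')) ≤ r₁' ∧
      0 < Rout ∧ 0 < Rout' ∧ Rout ≤ m₁ ∧ Rout' ≤ m₁' ∧ Rout ≤ h₀ ∧ Rout' ≤ h₀' ∧ 0 ≤ dS ∧
      lam + 5 * ε + 2 * dS < μ₀ ∧ lam' + 5 * ε' + 2 * dS < μ₀' ∧ 3 * ε < dB ∧ 3 * ε' < dB' ∧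
      2 * dS + 2 * ε < dB ∧ 2 * dS + 2 * ε' < dB' ∧ 0 < α₀ ∧ 0 < α₀' ∧
      3 * w ≤ c₀ ∧ w' ≤ c₁ ∧ 3 * ε + 3 * ε' < μ ∧ 3 * ε + 3 * ε' + ν < μ' ∧ 8 * ε + 8 * ε' ≤ μ₀ ∧
      2 * ε + 2 * dS < μS ∧ 0 < rbW ∧ rbW < rbP ∧ rbP ≤ rbF ∧ 0 < raW ∧ raW ≤ raP ∧ raP ≤ raF ∧
      raF ≤ ra / 4 ∧ raF ≤ ra' ∧ rbF ≤ rb / 4 ∧ rbF ≤ rb' ∧ ra ≤ ℓ ∧ rb ≤ ℓ ∧ 0 < ra ∧ 0 < rb ∧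
      ε ≤ ra / 4 ∧ ε ≤ rb / 4 ∧ Ttop + w ≤ T + 1 ∧ ε + 3 * ε' < 2 * dS ∧ ε' ≤ ε ∧
      d'' ≤ d' - ε - ε' ∧ d'' ≤ rbP - rbW - ε' ∧ d'' ≤ d') :
    ∀ s u t : I, s < u → u < t → ℓ ≤ dist (X s) (X u) → dist (X s) (X t) ≤ ε → False := by
  intro s₀ u₀ t₀ hsu hut hfar hret
  obtain ⟨hε, hε', h5ε, h5ε', hw, hw', hwθ, hwθ', hθc, hθc', hL2, hL2', hθ1, hθ1', hρ₁, hρ₁', hr₁, hr₁',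
    hr₁b, hr₁b', hRout, hRout', hRm, hRm', hRh, hRh', hdS, hlam, hlam', hdB3, hdB3', hdB2, hdB2',
    hα₀, hα₀', hwc, hwc', h33, h33ν, h88, hμS, hrbW, hrbWP, hrbPF, hraW, hraWP, hraPF,
    hraF4, hraF', hrbF4, hrbF', hraℓ, hrbℓ, hra, hrb, hεra, hεrb, hTtop, hdS2, hεε', hd''1, hd''2, hd''3⟩ := hnum
  obtain ⟨⟨hρc, hρim, hρ0, hshF, hinjF, hinj0F, hoscF, hMaF, hMbF, hbdF, hZaF⟩, hinjSF, hcontF, hmcF, hZretF,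
    hZbF, hZescF, hZtopF, hporF⟩ := hgoodF
  obtain ⟨⟨hρ'c, hρ'im, hρ'0, hshB, hinjB, hinj0B, hoscB, hMaB, hMbB, hbdB, hZaB⟩, hcontB⟩ := hgoodB
  /- ■ forward chain of `X` through `φ` -/
  set a : ℂ := D.pt 0 with ha
  set b : ℂ := D.pt 1 with hb
  set W : ℝ≥0 → ℝ := drivingFunction φ (CurveClass.mk X) with hWdef
  have hX0' : (CurveClass.mk X).source = D.pt 0 := by rw [CurveClass.source_mk]; exact hX0
  have hW : IsLoewnerDescribed φ (CurveClass.mk X) W := isLoewnerDescribed_drivingFunction hdescF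
  have hWc : Continuous W := hW.continuous
  have hW0 : W 0 = 0 := hW.driving_zero hφ hX0'
  have hgen : Loewner.IsGeneratedByCurve W (Loewner.trace W) := hW.exists_eq_mk_trace.1
  set γ : ℝ≥0 → ℂ := Loewner.trace W with hγ
  obtain ⟨hdict, hcapF⟩ := stub_latticeDictionary D φ hφ
  obtain ⟨hsimple, hcl, hseg⟩ := hdict X W hXinj hX0 hX1 hXint hW
  set Φ : ℂ → ℂ := φ.boundaryExtension with hΦ
  set Xf : ℝ≥0 → ℂ := fun t => Φ (γ t) with hXf
  set r : ℝ≥0 → ℂ := fun u => Φ (ρ u) with hr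
  have segF : ∀ t : ℝ≥0, ∃ u : I, X u = Xf t ∧ X '' Icc 0 u = Xf '' Icc 0 t := by
    intro t
    obtain ⟨u, h1, h2⟩ := hseg t
    exact ⟨u, h1, by rw [h2, image_image]⟩
  /- ■ backward chain of `X.reverse` through `φ'` -/
  set Xr : Curve ℂ := X.reverse with hXr
  have hXr_apply : ∀ t : I, Xr t = X (σ t) := fun t => rfl
  have hXrinj : Function.Injective Xr := by
    intro s t h
    rw [hXr_apply, hXr_apply] at h
    have := hXinj h
    simpa using congrArg σ this
  have hXr0 : Xr.source = D.swap.pt 0 := by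
    rw [MarkedDomain.pt_swap_zero, Curve.source_def, hXr_apply, unitInterval.symm_zero]
    exact hX1
  have hXr1 : Xr.target = D.swap.pt 1 := by
    rw [MarkedDomain.pt_swap_one, Curve.target_def, hXr_apply, unitInterval.symm_one]
    exact hX0
  have hXrint : ∀ t : I, Xr t = D.swap.pt 0 ∨ Xr t = D.swap.pt 1 ∨ Xr t ∈ D.swap.carrier := by
    intro t
    rw [MarkedDomain.pt_swap_zero, MarkedDomain.pt_swap_one, MarkedDomain.carrier_swap, hXr_apply]
    rcases hXint (σ t) with h | h | h
    · exact Or.inr (Or.inl h)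
    · exact Or.inl h
    · exact Or.inr (Or.inr h)
  set W' : ℝ≥0 → ℝ := drivingFunction φ' (CurveClass.mk Xr) with hW'def
  have hXr0' : (CurveClass.mk Xr).source = D.swap.pt 0 := by rw [CurveClass.source_mk]; exact hXr0
  have hW' : IsLoewnerDescribed φ' (CurveClass.mk Xr) W' := isLoewnerDescribed_drivingFunction hdescB
  have hW'c : Continuous W' := hW'.continuous
  have hW'0 : W' 0 = 0 := hW'.driving_zero hφ' hXr0'
  have hgen' : Loewner.IsGeneratedByCurve W' (Loewner.trace W') := hW'.exists_eq_mk_trace.1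
  set γ' : ℝ≥0 → ℂ := Loewner.trace W' with hγ'
  obtain ⟨hdict', hcapB⟩ := stub_latticeDictionary D.swap φ' hφ'
  obtain ⟨hsimple', hcl', hseg'⟩ := hdict' Xr W' hXrinj hXr0 hXr1 hXrint hW'
  set Φ' : ℂ → ℂ := φ'.boundaryExtension with hΦ'
  set Xb : ℝ≥0 → ℂ := fun t => Φ' (γ' t) with hXb
  set r' : ℝ≥0 → ℂ := fun u => Φ' (ρ' u) with hr'
  have segB : ∀ t : ℝ≥0, ∃ u : I, X u = Xb t ∧ X '' Icc u 1 = Xb '' Icc 0 t := by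
    intro t
    obtain ⟨u, h1, h2⟩ := hseg' t
    refine ⟨σ u, h1, ?_⟩
    have e1 : Xr '' Icc 0 u = (fun x => X (σ x)) '' Icc 0 u := image_congr fun x _ => hXr_apply x
    rw [← image_symm_Icc_zero, image_image, ← e1, h2, image_image]
  /- ■ continuity, injectivity, tops -/
  have hΦc : ContinuousOn Φ {z : ℂ | 0 ≤ z.im} := continuousOn_boundaryExtension_im_nonneg φ
  have hΦ'c : ContinuousOn Φ' {z : ℂ | 0 ≤ z.im} := continuousOn_boundaryExtension_im_nonneg φ'
  have hXfc : Continuous Xf := hΦc.comp_continuous hgen.continuous fun t => hgen.im_nonneg t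
  have hXbc : Continuous Xb := hΦ'c.comp_continuous hgen'.continuous fun t => hgen'.im_nonneg t
  have hrc : Continuous r := hΦc.comp_continuous hρc fun u => hρim u
  have hr'c : Continuous r' := hΦ'c.comp_continuous hρ'c fun u => hρ'im u
  have injXf : InjOn Xf (Icc 0 (T + 1)) := by
    intro s _ t _ h
    exact hsimple.1 (JordanDomain.injOn_boundaryExtension φ (hgen.im_nonneg s) (hgen.im_nonneg t) h)
  have injXb : InjOn Xb (Icc 0 (T' + 1)) := by
    intro s _ t _ h
    exact hsimple'.1 (JordanDomain.injOn_boundaryExtension φ' (hgen'.im_nonneg s) (hgen'.im_nonneg t) h)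
  obtain ⟨utop, htopPt, htop⟩ := segF (T + 1)
  obtain ⟨ubot, hbotPt, hbot⟩ := segB (T' + 1)
  have hΦ0 : Φ 0 = a := MarkedDomain.IsChordalUniformizing.boundaryExtension_zero hφ
  have hΦ'0 : Φ' 0 = b := by
    rw [hb, ← MarkedDomain.pt_swap_zero]
    exact MarkedDomain.IsChordalUniformizing.boundaryExtension_zero hφ'
  /- ■ shadows -/
  have shF0 : ∀ t : ℝ≥0, (t : ℝ) ≤ T + 1 →
      hausdorffDist (Φ '' (γ '' Icc 0 t)) ((fun u => Φ (ρ u)) '' Icc 0 t) ≤ ε := by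
    intro t ht
    by_cases h0 : t = 0
    · subst h0
      rw [Icc_self, image_singleton, image_singleton, image_singleton, hgen.apply_zero, hW0, Complex.ofReal_zero, hρ0,
        hausdorffDist_self_zero]
      exact hε.le
    · have hpos : 0 < t := pos_iff_ne_zero.2 h0
      rw [← hcl t hpos]
      exact hshF t hpos ht
  have shF : ∀ t : ℝ≥0, (t : ℝ) ≤ T + 1 → hausdorffDist (Xf '' Icc 0 t) (r '' Icc 0 t) ≤ ε := by
    intro t ht
    have := shF0 t ht
    rwa [image_image] at this
  have shB0 : ∀ t : ℝ≥0, (t : ℝ) ≤ T' + 1 →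
      hausdorffDist (Φ' '' (γ' '' Icc 0 t)) ((fun u => Φ' (ρ' u)) '' Icc 0 t) ≤ ε' := by
    intro t ht
    by_cases h0 : t = 0
    · subst h0
      rw [Icc_self, image_singleton, image_singleton, image_singleton, hgen'.apply_zero, hW'0, Complex.ofReal_zero, hρ'0,
        hausdorffDist_self_zero]
      exact hε'.le
    · have hpos : 0 < t := pos_iff_ne_zero.2 h0
      rw [← hcl' t hpos]
      exact hshB t hpos ht
  have shB : ∀ t : ℝ≥0, (t : ℝ) ≤ T' + 1 → hausdorffDist (Xb '' Icc 0 t) (r' '' Icc 0 t) ≤ ε' := by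
    intro t ht
    have := shB0 t ht
    rwa [image_image] at this
  /- ■ the two Flank Lemmas -/
  have hF0 := stub_flankL D φ hφ W γ ρ hWc hgen hsimple hρc hρim T ε μ μ₀ w θ c₀ ρ₁ m₁ h₀ d' dS lam r₁
    Rout α₀ dB L hε h5ε hw hwθ hθc hL2 hθ1 hρ₁ hr₁ hr₁b hRout hRm hRh hdS hlam hdB3 hdB2 hα₀ shF0 hinjF
    hinj0F hoscF hMaF hMbF hbdF (fun t₁ _ => hgate W hWc t₁)
  have hB0 := stub_flankL D.swap φ' hφ' W' γ' ρ' hW'c hgen' hsimple' hρ'c hρ'im T' ε' μ' μ₀' w' θ' c₁ ρ₁'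
    m₁' h₀' d'' dS lam' r₁' Rout' α₀' dB' L' hε' h5ε' hw' hwθ' hθc' hL2' hθ1' hρ₁' hr₁' hr₁b' hRout' hRm'
    hRh' hdS hlam' hdB3' hdB2' hα₀' shB0 hinjB hinj0B hoscB hMaB hMbB hbdB (fun t₁ _ => hgate' W' hW'c t₁)
  /- ■ windows -/
  have monoF : ∀ (t t' : ℝ≥0) (u u' : I), t ≤ t' → X '' Icc 0 u = Xf '' Icc 0 t →
      X '' Icc 0 u' = Xf '' Icc 0 t' → u ≤ u' := fun t t' u u' => le_of_image_Icc_zero_eq X hXinj Xf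
  have monoB : ∀ (t t' : ℝ≥0) (u u' : I), t ≤ t' → X '' Icc u 1 = Xb '' Icc 0 t →
      X '' Icc u' 1 = Xb '' Icc 0 t' → u' ≤ u := fun t t' u u' => le_of_image_Icc_one_eq X hXinj Xb
  obtain ⟨tb, htbT, hdb⟩ := hapF
  obtain ⟨vb, hvbPt, hvbseg⟩ := segF tb
  have hdb' : dist (X vb) b ≤ rb'' := by rw [hvbPt]; exact hdb.le
  have hvbtop : vb ≤ utop := monoF tb (T + 1) vb utop (htbT.trans le_self_add) hvbseg htop
  have Wf0 : ∀ v : I, utop < v → dist (X v) b < rbW :=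
    fun v hv => nB6 vb v (hvbtop.trans_lt hv) hdb'
  have Wf : ∀ v : I, utop < v → dist (X v) b < rbP := fun v hv => (Wf0 v hv).trans hrbWP
  have capF : ∀ v : I, rbP ≤ dist (X v) b → X v ∈ Xf '' Icc 0 T := by
    intro v hv
    obtain ⟨uT, -, hsegT⟩ := segF T
    rcases le_or_gt v uT with h | h
    · rw [← hsegT]
      exact ⟨v, ⟨v.2.1, h⟩, rfl⟩
    · exfalso
      have hvbT : vb ≤ uT := monoF tb T vb uT htbT hvbseg hsegT
      have := nB6 vb v (hvbT.trans_lt h) hdb'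
      linarith
  obtain ⟨ta, htaT, hda⟩ := hapB
  obtain ⟨va, hvaPt, hvaseg⟩ := segB ta
  have hda' : dist (X va) a < ra'' := by
    rw [hvaPt]
    exact hda
  have hvabot : ubot ≤ va := monoB ta (T' + 1) va ubot (htaT.trans le_self_add) hvaseg hbot
  have Wb0 : ∀ v : I, v < ubot → dist (X v) a < raW := by
    intro v hv
    by_contra h
    push Not at h
    have := nB5 v va (hv.trans_le hvabot) h
    linarith
  have Wb : ∀ v : I, v < ubot → dist (X v) a < raP := fun v hv => (Wb0 v hv).trans_le hraWP
  have capB : ∀ v : I, raP ≤ dist (X v) a → X v ∈ Xb '' Icc 0 T' := by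
    intro v hv
    obtain ⟨uT', -, hsegT'⟩ := segB T'
    rcases le_or_gt uT' v with h | h
    · rw [← hsegT']
      exact ⟨v, ⟨h, v.2.2⟩, rfl⟩
    · exfalso
      have hvaT : uT' ≤ va := monoB ta T' va uT' htaT hvaseg hsegT'
      have := nB5 v va (h.trans_le hvaT) (hraWP.trans hv)
      linarith
  /- ■ the compatibility lemma, with Compat's `Ttop` localised at a far reference time `u₃` -/
  have hcontB' : ∀ s t : ℝ≥0, (s : ℝ) ≤ T' + 1 → (t : ℝ) ≤ T' + 1 → |(s : ℝ) - t| ≤ c₁ →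
      dist (r' s) (r' t) < μ₀ - 4 * ε - 4 * ε' := fun s t hs ht hst => by
    have := hcontB s t hs ht hst
    linarith
  have Z5 : ∀ v v' : I, v ≤ v' → dist (X v) b ≤ rbW → dist (X v') b < rbP := by
    intro v v' hvv' hd
    rcases hvv'.lt_or_eq with h | h
    · exact nB7 v v' h hd
    · rw [← h]; linarith
  have hT1 : ((T + 1 : ℝ≥0) : ℝ) ≤ T + 1 := by push_cast; exact le_rfl
  have hT1' : ((T' + 1 : ℝ≥0) : ℝ) ≤ T' + 1 := by push_cast; exact le_rfl
  have hC : ∀ v₁ v₂ : I, ∀ u₁ u₂ u₃ : ℝ≥0, (u₂ : ℝ) + 2 * w ≤ u₃ → (u₃ : ℝ) ≤ Ttop →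
      rbF - ε ≤ dist (r u₃) b → dist (X v₁) (r u₁) ≤ 2 * ε →
      dist (X v₂) (r u₂) ≤ 2 * ε → (u₁ : ℝ) + 2 * c₀ ≤ u₂ → ∀ u₁' u₂' : ℝ≥0, (u₁' : ℝ) ≤ T' + 1 →
      (u₂' : ℝ) ≤ T' + 1 → dist (X v₁) (r' u₁') ≤ 2 * ε' → dist (X v₂) (r' u₂') ≤ 2 * ε' →
      (u₂' : ℝ) + c₁ ≤ u₁' := by
    intro v₁ v₂ u₁ u₂ u₃ h23 h3T hfar3 hy₁ hy₂ hgap u₁' u₂' hu₁' hu₂' hy₁' hy₂'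
    have h3T1 : (u₃ : ℝ) ≤ T + 1 := by linarith
    have Z2 : ∀ u : ℝ≥0, (u : ℝ) ≤ ((u₃ : ℝ) - 2 * w) + 2 * w → rbP + 2 * ε + 3 * ε' < dist (r u) b := by
      intro u hu
      have hle : u ≤ u₃ := by
        have : (u : ℝ) ≤ u₃ := by linarith
        exact_mod_cast this
      have := hZescF u u₃ hle h3T1 hfar3
      linarith
    exact stub_compat X hXinj Xf Xb r r' T T' utop b ε ε' μ ν μ' μ₀ w w' c₀ c₁ ((u₃ : ℝ) - 2 * w) rbW rbP
      hXfc hXbc hrc hr'c hε hε' hw hw' hwc' (by linarith) hwc h33 h33ν hrbW hrbWP (by linarith)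
      (fun t _ => segF t) (fun t _ => segB t) htopPt htop shF shB hinjF hcontF hinj0F hinjB hcontB' Z2
      hZtopF Wf0 Z5 v₁ v₂ u₁ u₂ (by linarith) hy₁ hy₂ hgap u₁' u₂' hu₁' hu₂' hy₁' hy₂'
  /- ■ porosity in the core's form (farness of `e` from the backward reference) -/
  have por : ∀ (y : ℂ) (u : ℝ≥0), α₀ ≤ (u : ℝ) → (u : ℝ) ≤ Ttop + w → dist y (r u) ≤ ε →
      (∃ u₃ : ℝ≥0, u ≤ u₃ ∧ (u₃ : ℝ) ≤ T + 1 ∧ rbF - ε ≤ dist (r u₃) b) →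
      ∃ e ∈ D.carrier, dist e y ≤ 2 * dS ∧ d' ≤ infDist e (r '' Icc 0 (T + 1) ∪ frontier D.carrier) ∧
        d'' ≤ infDist e (r' '' Icc 0 (T' + 1) ∪ frontier D.carrier) := by
    intro y u hu1 hu2 hy ⟨u₃, huu₃, hu₃T, hfar3⟩
    obtain ⟨e, heD, hey, he'⟩ := hporF y u hu1 hu2 hy
    refine ⟨e, heD, hey, he', ?_⟩
    have hyb : rbP + 2 * dS ≤ dist y b := by
      have h1 := hZescF u u₃ huu₃ hu₃T hfar3
      have h2 := dist_triangle (r u) y b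
      rw [dist_comm (r u) y] at h2
      linarith
    have heb : rbP ≤ dist e b := by
      have h2 := dist_triangle y e b
      rw [dist_comm y e] at h2
      linarith
    exact le_infDist_bwd X Xf Xb r r' hXfc hXbc hrc hr'c htop hbot (shF (T + 1) hT1) (shB (T' + 1) hT1') Wf0 he'
      heb hd''1 hd''2 hd''3
  /- ■ the three points of the return are far from `a` and `b` -/
  obtain ⟨hsb, hua, hub, hta, htb⟩ := far_of_return X a b nB1 nB2 nB3 nB4 hsu hut hfar hret hraF4 hraF' hrbF4
    hrbF' hraℓ hrbℓ hεra hεrb hra hrb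
  have hZaB' : ∀ u' : ℝ≥0, (u' : ℝ) ≤ T' + 1 → (u' : ℝ) < α₀' → dist (r' u') b < rbP - ε' := by
    intro u' hu' hlt
    have := hZaB u' hu' hlt
    rwa [MarkedDomain.pt_swap_zero] at this
  /- ■ the deterministic core -/
  exact PathUpgradeRCore.no_return X hXinj a b Xf Xb r r' hrc hr'c T T' utop ubot D.carrier
    (frontier D.carrier) ε ε' μ μS w c₀ c₁ Ttop α₀ α₀' dS d' d'' raF rbF raP rbP ℓ hε hε' hw (by linarith)
    hraPF hrbPF (by linarith) hμS (fun t _ => segF t) (fun t _ => segB t) htop hbot injXf injXb shF shB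
    hinjF hinjSF hmcF hF0 hB0 hC por Wf Wb hZbF hZescF hZaF hZretF hZaB' capF capB s₀ u₀ t₀ hsu hut hfar hret
    hsb hua hub hta htb

end Summit.CriticalPhenomena.SAWScalingLimit.Theorems.PathUpgradeRInst

namespace Summit.CriticalPhenomena.SAWScalingLimit.Theorems

/-- Registered auxiliary stub `stub_returnsDie_inst` of crux stmt-CriticalPhenomena-18055 (line `bidir_windows`): the
image of an initial interval under the symmetry of the unit interval (`PathUpgradeRInst.image_symm_Icc_zero`, used
to turn initial segments of the reversed curve into final segments). [folklore] -/
theorem stub_returnsDie_inst : ∀ u : unitInterval, unitInterval.symm '' Set.Icc 0 u = Set.Icc (unitInterval.symm u) 1 :=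
  PathUpgradeRInst.image_symm_Icc_zero

end Summit.CriticalPhenomena.SAWScalingLimit.Theorems

end
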